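import Summits.Ventures.YMGap.Thresholds.StrongCouplingAnalytic
import HarnessLib

/-!
# `f'(β) = −e(ν_β)` near `β = 0` for EVERY compact gauge group: the free energy density is differentiable with
# derivative minus the energy density of the torus-limit state (row type C-PRESS, every-group endpoint)

Cell `pub-ymgap`, seat ds-1 (gen 14). HONEST FRAMING: strong-coupling LATTICE statements for the Wilson action of an
ARBITRARY compact metrisable gauge group `G`, continuous representation `ρ`, every `d`, on the corner
`|β| < β₀ := betaOne d ρ / 4` of the coupling axis (the tree's Osterwalder–Seiler torus-expansion radius; for `SU(2)`,
`d = 4`, `β₀ ≈ 10⁻⁶⁷³` — positive but absurdly small); a thermodynamic identity, NOT a statement about the window,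
the continuum, or the Clay problem. Kernel theorems only, 0 compute; the one parent is a built tree module.

The tree had the identity `f'(β) = −e(μ_β) = −Σ_{i<j} (N − ⟨Re tr ρ(U_{p_ij})⟩_{μ_β})` for `SU(2)`/`SU(N)` on the
vertex-star windows (this seat's gens 9: `PressureRegularity.su2_hasDerivAt_freeEnergyDensity`,
`hasDerivAt_freeEnergyDensity_SU_thooft`, …), where continuity of the state in `β` came from the Dobrushin
technology, and the GENERAL mechanism `PressureRegularity.hasDerivAt_freeEnergyDensity` (energy-subgradient chords +
a translation-invariant DLR selection with continuous plaquette expectations). Gen 13's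
`StrongCouplingAnalytic.exists_analytic_dlr_selection` supplies, for EVERY `G`, such a selection near `β = 0`: the
thermodynamic limit `ν_β` of the torus Wilson states, along which every bounded continuous cylinder expectation is
real-analytic on `(−β₀, β₀)`; it is translation invariant as a torus limit point
(`isZdTranslationInvariant_of_mem_infiniteVolumeLimitPoints`). Hence:

* ★ `exists_torusLimit_hasDerivAt_freeEnergyDensity` — every `d`, `G`, `ρ`: along the torus-limit DLR selection `ν`,
  `HasDerivAt f (−e(ν_β)) β` for every `|β| < β₀`; `deriv` form `deriv_freeEnergyDensity_eq_neg_energy_torusLimit`.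
* ★ `hasDerivAt_freeEnergyDensity_of_mem_infiniteVolumeLimitPoints` — the same with `e(μ)` for EVERY torus limit point
  `μ` at `β` (all limit points share their cylinder expectations there: the full sequence converges).
* `hasDerivAt_freeEnergyDensity_of_subsingleton` — wherever `𝒢(β)` is a singleton (`|β| < β₀`), `f'(β) = −e(μ)` for
  the DLR state `μ`; `analyticOnNhd_energy_torusLimit` — the energy density `β ↦ e(ν_β)`, hence `f'`, is real-analytic
  on `(−β₀, β₀)`.

References (mechanism, in the tree): Friedli–Velenik, *Statistical Mechanics of Lattice Systems* (2017) Prop. 6.91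
(energy–pressure chords); Osterwalder–Seiler, Ann. Phys. 110 (1978) 440, Thms. 3.6–3.7 (the torus expansion).
-/

noncomputable section

open MeasureTheory Set Filter Topology
open Literature.MathematicalPhysics.QuantumLattice (LGConfig ZdEdge ZdPlaquette ymGibbsMeasures plaquetteObs
  freeEnergyDensity IsCylinder infiniteVolumeLimitPoints IsInfiniteVolumeLimit IsZdTranslationInvariant
  toTorusObservable originPlaquetteSupport isCylinder_plaquetteObs_zero continuous_plaquetteObs
  IsInfiniteVolumeLimit.mem_infiniteVolumeLimitPoints isZdTranslationInvariant_of_mem_infiniteVolumeLimitPoints)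
open Literature.MathematicalPhysics.QuantumFieldTheory hiding ZdEdge IsInfiniteVolumeLimit
open Summit.Ventures.YMGap.StrongCouplingAnalytic (exists_analytic_dlr_selection integral_eq_of_mem_infiniteVolumeLimitPoints)

namespace Summit.Ventures.YMGap.PressureAllGroups

variable {d N : ℕ} {G : Type} [Group G] [TopologicalSpace G] [IsTopologicalGroup G] [CompactSpace G]
  [MeasurableSpace G] [BorelSpace G] [SecondCountableTopology G] [T2Space G] (ρ : G →* Matrix (Fin N) (Fin N) ℂ)

/-- Local shorthand: the planes `{(i, j) : i < j}`. -/
local notation3 (prettyPrint := false) "𝔓" d => {q : Fin d × Fin d // q.1 < q.2}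

omit [MeasurableSpace G] [BorelSpace G] [SecondCountableTopology G] [T2Space G] in
/-- The plaquette observable at the origin is a bounded continuous cylinder observable (compactness of `G`).
[folklore] -/
theorem exists_abs_plaquetteObs_zero_le (hρ : Continuous ρ) (i j : Fin d) :
    ∃ C, ∀ U : LGConfig d G, |plaquetteObs ρ 0 i j U| ≤ C := by
  have hc : Continuous (plaquetteObs (G := G) ρ 0 i j) := continuous_plaquetteObs ρ hρ 0 i j
  obtain ⟨C, hC⟩ := (HasCompactSupport.of_compactSpace _).exists_bound_of_continuous hc
  exact ⟨C, fun U => (Real.norm_eq_abs _).symm.le.trans (hC U)⟩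

/-- ★ **`f'(β) = −e(ν_β)` along the torus-limit state, EVERY compact gauge group.** For every `d`, every compact
metrisable `G` and every continuous representation `ρ` there is a DLR selection `β ↦ ν_β ∈ 𝒢(β)` — THE thermodynamic
limit of the torus Wilson states (`IsInfiniteVolumeLimit`) at every `|β| < β₀ = betaOne d ρ / 4` — such that the free
energy density satisfies `HasDerivAt f (−Σ_{i<j} (N − ∫ Re tr ρ(U_{p_ij}) dν_β)) β` at every `|β| < β₀`. The selection is
gen 13's analytic one (`exists_analytic_dlr_selection`); it is translation invariant as a torus limit point
(`isZdTranslationInvariant_of_mem_infiniteVolumeLimitPoints`) and its plaquette expectations are continuous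
(indeed analytic), so `PressureRegularity.hasDerivAt_freeEnergyDensity` (energy-subgradient chords) applies.
[cite: FriedliVelenikSMLS2017, Prop. 6.91 with Thm. B.12] -/
theorem exists_torusLimit_hasDerivAt_freeEnergyDensity (hρ : Continuous ρ) :
    ∃ ν : ℝ → Measure (LGConfig d G),
      (∀ β : ℝ, |β| < betaOne d ρ / 4 → ν β ∈ ymGibbsMeasures ρ β ∧ IsInfiniteVolumeLimit ρ β (ν β)) ∧
      (∀ (F : LGConfig d G → ℝ) (B : Finset (ZdEdge d)), IsCylinder F B → Continuous F → (∃ C, ∀ U, |F U| ≤ C) →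
        AnalyticOnNhd ℝ (fun β => ∫ U, F U ∂(ν β)) (Ioo (-(betaOne d ρ / 4)) (betaOne d ρ / 4))) ∧
      ∀ β : ℝ, |β| < betaOne d ρ / 4 →
        HasDerivAt (freeEnergyDensity d ρ)
          (-∑ q : 𝔓 d, ((N : ℝ) - ∫ U, plaquetteObs ρ 0 q.1.1 q.1.2 U ∂(ν β))) β := by
  obtain ⟨ν, hν, han⟩ := exists_analytic_dlr_selection (d := d) ρ hρ
  refine ⟨ν, hν, han, fun β hβ => ?_⟩
  have hβ' : β ∈ Ioo (-(betaOne d ρ / 4)) (betaOne d ρ / 4) := ⟨(abs_lt.1 hβ).1, (abs_lt.1 hβ).2⟩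
  refine PressureRegularity.hasDerivAt_freeEnergyDensity ρ hρ (S := Ioo (-(betaOne d ρ / 4)) (betaOne d ρ / 4))
    (μ := ν) (fun b hb => (hν b (abs_lt.2 ⟨hb.1, hb.2⟩)).1)
    (fun b hb => isZdTranslationInvariant_of_mem_infiniteVolumeLimitPoints ρ
      (hν b (abs_lt.2 ⟨hb.1, hb.2⟩)).2.mem_infiniteVolumeLimitPoints)
    (isOpen_Ioo.mem_nhds hβ') fun q => ?_
  exact (han _ _ (isCylinder_plaquetteObs_zero ρ q.1.1 q.1.2) (continuous_plaquetteObs ρ hρ 0 _ _)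
    (exists_abs_plaquetteObs_zero_le ρ hρ _ _) β hβ').continuousAt

/-- **`deriv` form**: along the torus-limit selection, `deriv f β = −e(ν_β)` for every `|β| < β₀`. [folklore] -/
theorem deriv_freeEnergyDensity_eq_neg_energy_torusLimit (hρ : Continuous ρ) :
    ∃ ν : ℝ → Measure (LGConfig d G),
      (∀ β : ℝ, |β| < betaOne d ρ / 4 → ν β ∈ ymGibbsMeasures ρ β ∧ IsInfiniteVolumeLimit ρ β (ν β)) ∧
      ∀ β : ℝ, |β| < betaOne d ρ / 4 →
        deriv (freeEnergyDensity d ρ) β = -∑ q : 𝔓 d, ((N : ℝ) - ∫ U, plaquetteObs ρ 0 q.1.1 q.1.2 U ∂(ν β)) := by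
  obtain ⟨ν, hν, -, hd⟩ := exists_torusLimit_hasDerivAt_freeEnergyDensity (d := d) ρ hρ
  exact ⟨ν, hν, fun β hβ => (hd β hβ).deriv⟩

omit [SecondCountableTopology G] [T2Space G] in
/-- **All torus limit points share their cylinder expectations near `β = 0`**: if `μ` is an infinite-volume limit point
of the torus Wilson states at `|β| < β₀` (along any subsequence) and `ν` is the full-sequence limit there, then
`∫ F dμ = ∫ F dν` for every bounded continuous cylinder observable `F`. [folklore] -/
theorem integral_eq_integral_of_mem_infiniteVolumeLimitPoints {β : ℝ} {μ ν : Measure (LGConfig d G)}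
    (hμ : μ ∈ infiniteVolumeLimitPoints ρ β) (hν : IsInfiniteVolumeLimit ρ β ν)
    {F : LGConfig d G → ℝ} {B : Finset (ZdEdge d)} (hFB : IsCylinder F B) (hFc : Continuous F) {C : ℝ}
    (hFb : ∀ U, |F U| ≤ C) : ∫ U, F U ∂μ = ∫ U, F U ∂ν :=
  integral_eq_of_mem_infiniteVolumeLimitPoints ρ hFB hFc hFb (g := fun _ => ∫ U, F U ∂ν)
    (by simpa using hν.2 F B hFB hFc ⟨C, hFb⟩) hμ

/-- ★ **`f'(β) = −e(μ)` for EVERY torus limit point `μ` at `|β| < β₀`, every compact gauge group.** [folklore] -/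
theorem hasDerivAt_freeEnergyDensity_of_mem_infiniteVolumeLimitPoints (hρ : Continuous ρ) {β : ℝ}
    (hβ : |β| < betaOne d ρ / 4) {μ : Measure (LGConfig d G)} (hμ : μ ∈ infiniteVolumeLimitPoints ρ β) :
    HasDerivAt (freeEnergyDensity d ρ) (-∑ q : 𝔓 d, ((N : ℝ) - ∫ U, plaquetteObs ρ 0 q.1.1 q.1.2 U ∂μ)) β := by
  obtain ⟨ν, hν, -, hd⟩ := exists_torusLimit_hasDerivAt_freeEnergyDensity (d := d) ρ hρ
  have heq : ∀ q : 𝔓 d, ∫ U, plaquetteObs ρ 0 q.1.1 q.1.2 U ∂μ = ∫ U, plaquetteObs ρ 0 q.1.1 q.1.2 U ∂(ν β) := by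
    intro q
    obtain ⟨C, hC⟩ := exists_abs_plaquetteObs_zero_le (d := d) ρ hρ q.1.1 q.1.2
    exact integral_eq_integral_of_mem_infiniteVolumeLimitPoints ρ hμ (hν β hβ).2
      (isCylinder_plaquetteObs_zero ρ q.1.1 q.1.2) (continuous_plaquetteObs ρ hρ 0 _ _) hC
  simp only [heq]
  exact hd β hβ

/-- **`deriv` form for torus limit points**: `deriv f β = −e(μ)` for every torus limit point `μ` at `|β| < β₀`; in
particular all torus limit points at such `β` have the same energy density. [folklore] -/
theorem deriv_freeEnergyDensity_eq_of_mem_infiniteVolumeLimitPoints (hρ : Continuous ρ) {β : ℝ}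
    (hβ : |β| < betaOne d ρ / 4) {μ : Measure (LGConfig d G)} (hμ : μ ∈ infiniteVolumeLimitPoints ρ β) :
    deriv (freeEnergyDensity d ρ) β = -∑ q : 𝔓 d, ((N : ℝ) - ∫ U, plaquetteObs ρ 0 q.1.1 q.1.2 U ∂μ) :=
  (hasDerivAt_freeEnergyDensity_of_mem_infiniteVolumeLimitPoints ρ hρ hβ hμ).deriv

/-- **Under uniqueness, `f'(β) = −e(μ)` for THE DLR state**: if `𝒢(β)` is a subsingleton at some `|β| < β₀`, then for
every `μ ∈ 𝒢(β)`, `HasDerivAt f (−e(μ)) β` (the torus-limit state is a DLR state, hence `= μ`). [folklore] -/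
theorem hasDerivAt_freeEnergyDensity_of_subsingleton (hρ : Continuous ρ) {β : ℝ} (hβ : |β| < betaOne d ρ / 4)
    (hsub : (ymGibbsMeasures (d := d) ρ β).Subsingleton) {μ : Measure (LGConfig d G)}
    (hμ : μ ∈ ymGibbsMeasures (d := d) ρ β) :
    HasDerivAt (freeEnergyDensity d ρ) (-∑ q : 𝔓 d, ((N : ℝ) - ∫ U, plaquetteObs ρ 0 q.1.1 q.1.2 U ∂μ)) β := by
  obtain ⟨ν, hν, -, hd⟩ := exists_torusLimit_hasDerivAt_freeEnergyDensity (d := d) ρ hρ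
  rw [hsub hμ (hν β hβ).1]
  exact hd β hβ

/-- **The energy density of the torus-limit state is real-analytic on `(−β₀, β₀)`** (a finite sum of analytic
plaquette expectations), EVERY compact gauge group; with `exists_torusLimit_hasDerivAt_freeEnergyDensity` this says
`f'` is real-analytic there. [folklore] -/
theorem analyticOnNhd_energy_torusLimit (hρ : Continuous ρ) :
    ∃ ν : ℝ → Measure (LGConfig d G),
      (∀ β : ℝ, |β| < betaOne d ρ / 4 → ν β ∈ ymGibbsMeasures ρ β ∧ IsInfiniteVolumeLimit ρ β (ν β)) ∧
      AnalyticOnNhd ℝ (fun β => -∑ q : 𝔓 d, ((N : ℝ) - ∫ U, plaquetteObs ρ 0 q.1.1 q.1.2 U ∂(ν β)))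
        (Ioo (-(betaOne d ρ / 4)) (betaOne d ρ / 4)) ∧
      ∀ β : ℝ, |β| < betaOne d ρ / 4 →
        HasDerivAt (freeEnergyDensity d ρ)
          (-∑ q : 𝔓 d, ((N : ℝ) - ∫ U, plaquetteObs ρ 0 q.1.1 q.1.2 U ∂(ν β))) β := by
  obtain ⟨ν, hν, han, hd⟩ := exists_torusLimit_hasDerivAt_freeEnergyDensity (d := d) ρ hρ
  refine ⟨ν, hν, ?_, hd⟩
  have h : ∀ q : 𝔓 d, AnalyticOnNhd ℝ (fun β => ∫ U, plaquetteObs ρ 0 q.1.1 q.1.2 U ∂(ν β))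
      (Ioo (-(betaOne d ρ / 4)) (betaOne d ρ / 4)) := fun q =>
    han _ _ (isCylinder_plaquetteObs_zero ρ q.1.1 q.1.2) (continuous_plaquetteObs ρ hρ 0 _ _)
      (exists_abs_plaquetteObs_zero_le ρ hρ _ _)
  intro β hβ
  have hs : AnalyticAt ℝ (fun b => ∑ q : 𝔓 d, ((N : ℝ) - ∫ U, plaquetteObs ρ 0 q.1.1 q.1.2 U ∂(ν b))) β :=
    Finset.analyticAt_fun_sum Finset.univ fun q _ => analyticAt_const.fun_sub (h q β hβ)
  exact hs.fun_neg

/-- ★ **`f'` is real-analytic on `(−β₀, β₀)`, EVERY compact gauge group** (it equals minus the analytic energy density of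
the torus-limit state there). [folklore] -/
theorem analyticOnNhd_deriv_freeEnergyDensity (hρ : Continuous ρ) :
    AnalyticOnNhd ℝ (deriv (freeEnergyDensity d ρ)) (Ioo (-(betaOne d ρ / 4)) (betaOne d ρ / 4)) := by
  obtain ⟨ν, -, han, hd⟩ := analyticOnNhd_energy_torusLimit (d := d) ρ hρ
  intro β hβ
  refine (han β hβ).congr ?_
  filter_upwards [isOpen_Ioo.mem_nhds hβ] with b hb
  exact ((hd b (abs_lt.2 ⟨hb.1, hb.2⟩)).deriv).symm

/-- **The free energy density is `C¹` (indeed continuously differentiable with analytic derivative) on `(−β₀, β₀)`,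
EVERY compact gauge group.** [folklore] -/
theorem differentiableOn_freeEnergyDensity (hρ : Continuous ρ) :
    DifferentiableOn ℝ (freeEnergyDensity d ρ) (Ioo (-(betaOne d ρ / 4)) (betaOne d ρ / 4)) := by
  obtain ⟨ν, -, -, hd⟩ := exists_torusLimit_hasDerivAt_freeEnergyDensity (d := d) ρ hρ
  exact fun β hβ => (hd β (abs_lt.2 ⟨hβ.1, hβ.2⟩)).differentiableAt.differentiableWithinAt

end Summit.Ventures.YMGap.PressureAllGroups

end
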